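import Mathlib
import HarnessLib
import HarnessLib.Audit
import Summits.CriticalPhenomena.Statement

/-!
Route: PercTorusSliceFilling

# Route PercTorusSliceFilling — the critical 3-torus computes theta(p_c): no torus giant +
thin-cluster rarity

It suffices to show X = ThinClusterRarity ∧ NoCriticalTorusGiant (card
CriticalPhenomena/PercolationContinuityZ3/torus-slice-filling-identity-v2).
NoCriticalTorusGiant (T-B): on the discrete torus T_n = (ℤ/nℤ)³ (`torusGraph 3 n`) at p = p_c(ℤ³),
for every ε > 0,
P(some open cluster has ≥ ε n³ vertices) → 0. ThinClusterRarity (TCR, pure ℤ³): E_{p_c}[ 1{0 ↔ ∂B(m)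
in B(m)} / |C^{B(m)}(0)| ] ≤ C m⁻³,
where C^{B(m)}(0) = {y : 0 ↔ y inside B(m)} is the box cluster of the origin. The engine is an
IDENTITY, not an estimate:
call a torus cluster SLICE-FILLING (sf) if in some direction i it meets every slice {y_i = t}; then
P_{T_n,p}(C(x) sf) =
P_{ℤ³,p}(diam_∞ C(0) ≥ n−1) ≥ θ(p) for all p and n ≥ 3 (support SliceFillingUpperBound), and the
number N_sf of sf clusters
obeys E N_sf ≤ n³ E_{ℤ³}[1{0 ↔ ∂B(m)}/|C^{B(m)}(0)|], m = ⌊(n−2)/2⌋ (support SliceFillingTransport).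
So TCR ⇒ (N_sf)_n tight
(crux TorusNonProliferation, T-A) and few sf clusters × no giant ⇒ sf density → 0 ⇒ θ(p_c) = 0.
Lean: `(∃ C : ℝ, ∀ m : ℕ, 1 ≤ m → ∫ ω, (Literature.Probability.Percolation.siteToBoundary 3
m).indicator (fun ω => ((Set.ncard {y : Literature.Probability.LatticeModels.Site 3 | ω ∈
Literature.Probability.Percolation.openConnIn (↑(Literature.Probability.LatticeModels.box 3 m)) 0 y}
: ℝ))⁻¹) ω ∂(Literature.Probability.Percolation.bondPercolation
(Literature.Probability.LatticeModels.zdGraph 3) (Literature.Probability.Percolation.criticalProbI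
3)) ≤ C / (m : ℝ) ^ 3) ∧ ∀ ε : ℝ, 0 < ε → Filter.Tendsto (fun n : ℕ =>
(Literature.Probability.Percolation.bondPercolation (Literature.Probability.LatticeModels.torusGraph
3 n) (Literature.Probability.Percolation.criticalProbI 3)).real {ω | ∃ x :
Literature.Probability.LatticeModels.TorusSite 3 n, ε * (n : ℝ) ^ 3 ≤
((Literature.Probability.Percolation.openCluster ω x).ncard : ℝ)}) Filter.atTop (nhds 0)`

## Assembly
Elementary probability on a finite graph, no named facts: fix δ > 0; TorusNonProliferation gives M
with P(N_sf ≥ M) ≤ δ for all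
n ≥ 3; put ε = δ/M. Pointwise V_sf := #{x : C(x) sf} = Σ_{sf clusters} |S| ≤ N_sf · max_x |C(x)|, so
on {N_sf < M} ∩ {no cluster
≥ ε n³} we have V_sf < δ n³, whence E V_sf ≤ δ n³ + n³ P(N_sf ≥ M) + n³ P(∃ x, |C(x)| ≥ ε n³).
SliceFillingUpperBound at p = p_c
and each x gives n³ θ(p_c) ≤ Σ_x P(C(x) sf) = E V_sf (linearity over the finite vertex set; every
event on the finite configuration
space is measurable). Hence θ(p_c) ≤ 2δ + P_{T_n,p_c}(ε-giant) → 2δ by NoCriticalTorusGiant; δ ↓ 0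
and θ ≥ 0 give
theta (zdGraph 3) 0 (criticalProbI 3) = 0, i.e. PercolationContinuityZ3
(percolationContinuityZ3_iff).

Rationale: WHY THIS LINE. Pass to the finite transitive quotients T_n = ℤ³/nℤ³, where ℤ³'s boundarylessness is
restored (no free/wired choice, full Aut(T_n) symmetry, exact bond/plaquette duality
DuncanKahleSchweinhart2025 Lemma 10, a covering tower T_n ← T_2n at FIXED p), through an exact
dictionary: below sup-diameter n−1 the quotient map is a local isomorphism of edge sets, so 'C(x)
misses a slice in every direction' on T_n and 'diam_∞ C(0) ≤ n−2' on ℤ³ have equal probability at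
every p (inclusion–exclusion over sub-boxes; the volume/congruence form of this coupling for d > 6
is HeydenreichVanDerHofstad2017 Prop 13.7 / BenjaminiSchramm1996 Thm 1) — hence θ(p) ≤
P_{T_n,p}(C(x) sf) with no limit interchange and no sprinkling, and the sf density of the critical
torus is an upper bound for θ(p_c) at each n.
The density then factors as (number of sf clusters) × (largest cluster)/n³: the first factor is
reduced by a transport identity N_sf = Σ_x 1{C(x) sf}/|C(x)| and a static local coupling to the ℤ³
box quantity of TCR (a hyperscaling statement in Coniglio/BorgsChayesKestenSpencer1999 form: O(1)
spanning-type clusters ⟺ d_f + β/ν = d, false above six dimensions by Aizenman1997 Thm 4), the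
second is EasoHutchcroft2024's critical-torus problem (Remark 1.4, read: 'not multiple giant
components at criticality' on (ℤ/nℤ)³ is open; their Thm 1.1 needs supercriticality at (1−ε)p) in
the sharper form 'no giant at all', which is NECESSARY for the conjunct (torus clusters are
stochastically dominated by ℤ³ clusters, HvdH Prop 13.7, plus Markov) and whose only independent
content is the exclusion of a giant-bearing jump world.
Imported areas: percolation on finite transitive graphs (EasoHutchcroft2024, Hutchcroft2021 §2
universal tightness, Alon–Benjamini–Stacey/Bourgain sharp thresholds), covering/quotient comparison
(BenjaminiSchramm1996, LyonsPeres2016 Thm 6.47), high-dimensional torus-vs-ℤ^d coupling technology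
(HeydenreichVanDerHofstad2017 Ch. 13) pointed at d = 3; no physical analogy beyond the Coniglio
bookkeeping identity. No prior route of the sub uses tori, quotients or finite transitive graphs
(the nine Theses files read); nearest relatives are the free-box cards nonproliferation-is-enough /
box-hyperscaling-gluing, whose in-box 'no giant' input is the unproven free-box folklore, replaced
here by the torus statement T-B; negatives index (1 SAW item) not touched.

RANKED CRUXES. #0 Target (target) — X = ThinClusterRarity ∧ NoCriticalTorusGiant (both parts spelled
out; see the two crux blocks). (why it might fail: T-B is Easo–Hutchcroft's open critical-torus
problem (unsprinkled); TCR is a d<6 hyperscaling statement (false for d>6) supported only by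
numerics d_f + β/ν = 2.523 + 0.477.) [EasoHutchcroft2024, Aizenman1997,
BorgsChayesKestenSpencer1999, arXiv:1302.0421]
#2 NoCriticalTorusGiant (crux) — T-B of the card: for Bernoulli bond percolation on the discrete
torus (ℤ/nℤ)³ (torusGraph 3 n) at the ℤ³-critical parameter p_c(ℤ³) (criticalProbI 3), for every ε >
0 the probability that some open cluster has at least ε n³ vertices tends to 0 as n → ∞. Necessary
for the conjunct (HvdH2017 Prop 13.7 domination + Markov); given TorusNonProliferation and
SliceFillingUpperBound it is equivalent to it. [difficulty: open-problem] (why it might fail: False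
exactly in a giant-bearing jump world: a critical torus giant of density ε forces θ(p_c) ≥ ε
(HvdH2017 Prop 13.7), so no cheap refutation; but no ℤ³-tool excludes it — EH2024 Rem 1.4 call the
unsprinkled critical (ℤ/nℤ)³ statement 'beyond present techniques'.) [EasoHutchcroft2024,
HeydenreichVanDerHofstad2017, Hutchcroft2021, DuncanKahleSchweinhart2025, BenjaminiSchramm1996]
#3 ThinClusterRarity (crux) — TCR of the card in BOX form (K_n(0) replaced by the box cluster, so
that only a static coupling is needed): there is C such that for all m ≥ 1, E_{p_c}[ 1{0 ↔
∂^{in}B(m) inside B(m)} · |{y : 0 ↔ y inside B(m)}|⁻¹ ] ≤ C/m³ on ℤ³ (B(m) = box 3 m = [−m,m]³,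
one-arm event siteToBoundary 3 m). Equivalently: a long arm with a thin box cluster is rare — P(A_m,
|C^{B(m)}(0)| < λ m³π(m)) ≲ λ^{1+κ} π(m) — i.e. hyperscaling d_f + β/ν = 3 with lower-tail control.
[difficulty: XL] (why it might fail: False for d>6 under η=0 (~L^{d−6} thin spanning clusters,
Aizenman1997 Thm 4): needs a d=3 input — the unproved gluing bound τ_{p_c}(0,x) ≳ π(|x|/2)² (2β/ν =
1+η) plus a lower tail of the arm-conditioned box volume; evidence numerical only (β/ν=0.477,
d_f=2.523).) [Aizenman1997, BorgsChayesKestenSpencer1999, Kesten1986, arXiv:1302.0421,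
HeydenreichVanDerHofstad2017]
#4 TorusNonProliferation (crux) — T-A of the card: at p_c(ℤ³) the number N_sf(T_n) of slice-filling
open clusters of the torus (clusters S = C(x) such that for some direction i every slice {y_i = t},
t ∈ ℤ/n, meets S) is tight: for every δ > 0 there is M with P(N_sf ≥ M) ≤ δ for all n ≥ 3. Follows
from ThinClusterRarity via SliceFillingTransport (support ThinClusterTransport); the assembly
consumes this form. [deps: ThinClusterRarity] [difficulty: L] (why it might fail: Fails iff sf
clusters proliferate at p_c: the PROVED picture for d>6 (N ~ n^{d−6}, barrier
SpanningClustersAboveSix) and the 'shattered' jump world (θ*>0, no torus giant ⇒ N_sf → ∞); d=3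
support is Monte Carlo only (E N_sf ≈ 1.5 flat for n ≤ 32, card data).) [Aizenman1997,
BorgsChayesKestenSpencer1999,
Summits/CriticalPhenomena/PercolationContinuityZ3/Ideas/torus-slice-filling-identity-v2.md,
arXiv:1302.0421]
#9 SliceFillingUpperBound (support) — Lemma A of the card, upper-bound direction, at any base point:
for all p, n ≥ 3 and x ∈ T_n, θ_{ℤ³}(p) ≤ P_{T_n,p}(C(x) is slice-filling). Proof: θ(p) ≤
P_{ℤ³}(diam_∞ C(0) ≥ n−1) = 1 − P(∃ s ∈ [0,n−2]³: C(0) ⊆ −s + [0,n−2]³); on the torus 'C(x) not sf'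
= ∃ t ∈ (ℤ/n ∖ {x_i})³: C(x) avoids the three slices {y_i = t_i}; both unions have identical
inclusion–exclusion expansions because an intersection of such events is 'C ⊆ B' for a sub-box B ∋
base point with ≤ n−1 points per side (torus side: the component of x in a product of arcs is the
product of the arcs through x), and for such B the event is determined by the edges inside B plus
its edge boundary, on which Torus.proj is a bijection respecting the event and both marginals are
Bernoulli(p) products (setBernoulli restricted; bondPercolation_map_shift for the base point).
[difficulty: provable-now] [HeydenreichVanDerHofstad2017, BenjaminiSchramm1996,
Summits/CriticalPhenomena/PercolationContinuityZ3/Ideas/torus-slice-filling-identity-v2.md]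
#9 SliceFillingTransport (support) — Lemma E of the card, box form: for all p and n ≥ 4, with m =
⌊(n−2)/2⌋, E_{T_n,p}[N_sf] ≤ n³ · E_{ℤ³,p}[1{0 ↔ ∂^{in}B(m) in B(m)}/|C^{B(m)}(0)|]. Proof: N_sf =
Σ_x 1{C(x) sf}/|C(x)| (each sf cluster contributes 1); for each x, sf ⇒ C(x) leaves proj(x̂ + B(m))
(2m+1 ≤ n−1, so some slice is missed by the projected box) through an inner-boundary vertex reached
inside it, and |C(x)| ≥ |C^{loc}(x)| (cluster of x inside proj(x̂+B(m))); the pair (exit event,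
|C^{loc}(x)|) is a function of the edges inside proj(x̂+B(m)), which Torus.proj identifies (graph
isomorphism, 2m ≤ n−2) with the edges inside x̂+B(m) ⊂ ℤ³, both carrying Bernoulli(p) product law;
translation invariance of bondPercolation (zdGraph 3) moves x̂ to 0. No transitivity of the torus
measure is needed. [difficulty: provable-now] [HeydenreichVanDerHofstad2017, LyonsPeres2016,
Summits/CriticalPhenomena/PercolationContinuityZ3/Ideas/torus-slice-filling-identity-v2.md]
#9 ThinClusterTransport (support) — ThinClusterRarity → TorusNonProliferation (spelled out). Proof:
by SliceFillingTransport at p = p_c and TCR, E N_sf ≤ n³ · C/m³ ≤ 512 C for n ≥ 4 (m = ⌊(n−2)/2⌋ ≥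
(n−3)/2 ≥ n/8); N_sf ≤ 27 for n = 3; Markov. [difficulty: provable-now]
[Summits/CriticalPhenomena/PercolationContinuityZ3/Ideas/torus-slice-filling-identity-v2.md,
Aizenman1997]

TWO-LAYER PLAN. Foreseen glued splits (none filed now): TorusNonProliferation ⇐ ThinClusterRarity →
SliceFillingTransport → TorusNonProliferation
(glue = ThinClusterTransport, already typed); ThinClusterRarity ⇐ ArmVolumeLowerTail (P_{p_c}(A_m,
|C^{B(m)}(0)| < λ m³ π_m) ≤ C λ^{1+κ} π_m
for λ ∈ (0,1], π_m = P(A_m): hyperscaling + lower tail in one line) → ThinClusterRarity by ∫₁^∞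
P(A_m, V < v) v⁻² dv; NoCriticalTorusGiant ⇐
CoveringTowerDomination (clusters of T_n are dominated by clusters of T_{2n} at the same p, the
fixed-p 'second parameter') →
SymmetricThresholdBelowPc (the Aut(T_n)-invariant event {V_sf ≥ c n³} has its sharp-threshold window
strictly inside the announced-foam
regime) → NoCriticalTorusGiant. Depth ≤ 1, k ≤ 3 each.

KILL CRITERIA. ¬NoCriticalTorusGiant (critical tori carry giants along a subsequence) refutes the
CONJUNCT itself via HvdH2017 Prop 13.7 (θ(p_c) ≥ ε):
close refuted:NoCriticalTorusGiant and report upward. ¬TorusNonProliferation (N_sf not tight at p_c: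
the shattered/high-d phenotype in
d = 3) kills the assembly: close refuted:TorusNonProliferation (the identity then certifies that
critical ℤ³ imitates d > 6).
¬ThinClusterRarity alone (e.g. a log m/m³ lower bound, or a fat lower tail κ ≤ 0) forces a pivot of
T-A to a disjointness/BK or
duality proof — restate rank 3, keep the route. PercolationContinuityZ3 proved elsewhere moots
everything; a proof of the free-box
folklore F1 does NOT moot T-B (T-B is stronger).

NOT DECOMPOSED YET. The full identity P_T(C(x) sf) = P_ℤ(diam_∞ ≥ n−1) and Cor. B (θ(p) = lim n⁻³ E
V_sf) — only the upper bound is load-bearing;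
Lemma D (covering domination, HvdH Prop 13.7 for SimpleGraph quotients) — motivates T-B's necessity,
not used by the assembly;
the jump dichotomy (U)/(S) via Hutchcroft2021 Thm 2.2; the sibling periodic-slab and ℤ×(ℤ/n)²
identities; DKS plaquette duality on
T_n as a tool for T-B; constants (512 C, m = ⌊(n−2)/2⌋) and measurability bookkeeping inside the
supports; any definition
(IsSliceFilling, numSliceFilling) a prover may introduce locally with --supports.

CHEAPEST FALSIFIER. One union-find Monte Carlo (kit, ~1 h): bond percolation at p = 0.2488118 on
T_n, n = 32…256 — (i) E N_sf vs n must stay flat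
(card, pure Python n ≤ 32: 1.56/1.57/1.51/1.54/1.46), growth like n^a, a > 0, kills
TorusNonProliferation and TCR; (ii) K_max/n³
must decay (≈ n^{−0.48}); a plateau kills NoCriticalTorusGiant numerically and signals a jump; (iii)
m³·E_ℤ[1{A_m}/|C^{B(m)}(0)|] on
free boxes m = 16…128 must stay bounded (direct test of ThinClusterRarity, incl. the lower-tail
exponent κ from the histogram of
|C^{B(m)}| given A_m). Not run here (plancard seat, hub compute-free); the identity itself was
MC-checked by the card at six (n,p) pairs to < 1.3σ.

NUMBERS. p_c(ℤ³, bond) = 0.24881182(10), wrapping probability R^{(x)} = 0.25780(6), d_f =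
2.52293(10) hence β/ν = 3 − d_f = 0.47707 under
hyperscaling (arXiv:1302.0421); independent η = −0.046(3) gives 2β/ν = 1 + η = 0.954, i.e. β/ν =
0.477 (arXiv:cond-mat/9805125) —
the two agree to 3 digits, the numerical case for TCR's exponent 3. d > 6, η = 0: N_L ≥ o(1) L^{d−6}
w.h.p. and spanning probability
→ 1 (Aizenman1997 Thm 4); d = 2: P(≥ k spanning clusters) ≤ e^{−αk²} (Aizenman1997 Thm 3), IIC
volume/(n²π_n) tight in (0,∞)
(Kesten1986 Thm (8)). Card MC at p_c, n = 8/12/16/24/32: E V_sf/n³ = .411/.338/.289/.242/.202 (slope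
−0.51), E K_max/n³ =
.352/.286/.251/.209/.179, law of N_sf ≈ {1: .6, 2: .3, 3: .08, 4: .01}. Items at open: 8 (3 cruxes,
3 supports, target, assembly).

DEFINITION REQUESTS. None. torusGraph/TorusSite/Torus.proj (Literature.Probability.LatticeModels),
bondPercolation/openCluster/openConnIn/siteToBoundary/theta/
criticalProbI (Literature.Probability.Percolation) and box exist; slice-filling and N_sf are written
inline
({S | (∃ x, S = openCluster ω x) ∧ ∃ i, ∀ t, ∃ y ∈ S, y i = t}.ncard). Bib entries
EasoHutchcroft2024 and DuncanKahleSchweinhart2025 added this session.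

Novelty: Searches (2026-08-15, this planner; local searchd DOWN (connection reset ×2), OpenAlex/arXiv HTTP
429, galaxy --star all queued-out ×2 — recorded in NOTES.md): `lit search --source zbmath
"percolation torus critical giant component"` (6: Bobrowski–Skraba homological giant k-cycles,
Sivakoff Hamming torus, DKS-adjacent — none at p_c(ℤ³)); `--source zbmath "supercritical percolation
finite transitive graphs uniqueness giant"` (3: EasoHutchcroft2024, Easo 2023 threshold existence,
arXiv:2607.18011 local giants/long-range); `--source zbmath "spanning clusters percolation"` (15:
Aizenman1997, Cardy 1998/2002, Járai 2003 …); `"homological percolation torus plaquettes"` (2: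
DuncanKahleSchweinhart2025, Duncan–Schweinhart CMP 2025); `lit frontier CriticalPhenomena --since
2020` (30 rows, nothing on critical tori in d = 3); READ: EasoHutchcroft2024 p.4 Remark 1.4
(verbatim open problem), Kesten1986 pp.1–4 (Thm (8)); the card's and refuter triage-11's searches
(HvdH2017 Prop 13.7 pp.161–162 read; HvH CMP 2007 Prop 2.1; DKS Thm 2/Lemma 10; Hutchcroft2021 Thms
2.1–2.3) inherited and cited.
Nearest prior art found: HeydenreichVanDerHofstad2017 Prop 13.7 (= BenjaminiSchramm1996 Thm 1
lifting): |C_T(0)| ≤_st |C_ℤ(0)|, and Heydenreich–van der Hofstad CMP 270 (2007) Prop 2.1: torus and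
ℤ^d explorations agree until two explored points are congruent mod n — the volume/congruence form,
used for d > 6; EasoHutchcroft2024 Rem 1.4 states the critical-torus problem;
BorgsChayesKestenSpencer1999/Aizen  [refs: 2607.18011, EasoHutchcroft2024, Aizenman1997, DuncanKahleSchweinhart2025, Kesten1986, Hutchcroft2021, HeydenreichVanDerHofstad2017, BenjaminiSchramm1996, BorgsChayesKestenSpencer1999]

Barriers (technique_class: finite-quotient-identity, torus-giant, hyperscaling): - technique_class: finite-quotient-identity, torus-giant, hyperscaling
- Literature.Barriers.CriticalPhenomena.SpanningClustersAboveSix: APPLIES to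
ThinClusterRarity/TorusNonProliferation and is embraced — under η = 0, d > 6 the identity itself
manufactures N_sf ~ n^{d−6}, so TCR is by design a d < 6 (hyperscaling) input and any proof must use
d = 3; NoCriticalTorusGiant is dimension-free in form and TRUE for d > 6 (many thin spanning
clusters, no giant): the pair (TCR, T-B) splits exactly along the barrier.
- Literature.Barriers.CriticalPhenomena.SprinklingRenormalisation: located, not evaded — T-B is the
η = 0 (same-p) shadow of Easo–Hutchcroft's sprinkled uniqueness theorem; the bet is that the torus
supplies same-p substitutes for the second parameter (covering tower T_n ← T_2n at fixed p,
Aut(T_n)-symmetric sharp thresholds, DKS plaquette duality where closed 2-cycles form a group); no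
Grimmett–Marstrand block step is used anywhere.
- Literature.Barriers.CriticalPhenomena.SlabLimitUniformControl: evaded — the tori are quotients,
not an exhaustion; SliceFillingUpperBound is an inequality at each fixed n and nothing passes to a
limit inside a probability (no p_c(k) → p_c interchange).
- Literature.Barriers.CriticalPhenomena.LongRangeDiscontinuity: evaded by construction — the
identity needs the two lifts of a torus edge to be n apart (finite range); for the Aizenman–Newman
1/r² chain no finite quotient is locally isomorphic and the critical cycle ℤ/nℤ IS giant-bearing
(the

sub-problem: PercolationContinuityZ3 · status: draft · opened planner-plancard-CriticalPhenomena-Percolatio-a8700403-0 2026-08-15T11:41:05Z · rev 3 · ledger route-CriticalPhenomena-PercTorusSliceFilling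
GENERATED by the gate from the ledger (D-0016/17). Provers cite these decls: `theorem foo : Summit.CriticalPhenomena.PercolationContinuityZ3.Theses.PercTorusSliceFilling.<Decl> := …` in Summits/CriticalPhenomena/PercolationContinuityZ3/Theorems/<Name>.lean.
-/

namespace Summit.CriticalPhenomena.PercolationContinuityZ3.Theses.PercTorusSliceFilling

open scoped BigOperators Topology Manifold Classical MeasureTheory ProbabilityTheory Matrix InnerProductSpace ComplexConjugate ContinuousMap
open Filter Set Function TopologicalSpace MeasureTheory

attribute [summit_statement] _root_.PercolationContinuityZ3

/-- item stmt-CriticalPhenomena-5406 · target · rank 0 · open · by planner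
why it might fail: Conjunction of two OPEN statements: T-B (no critical torus giant, unsprinkled) is EH2024 Rem 1.4's open problem — even 'no multiple giants at p_c on (Z/nZ)^3' is open; TCR is d=3 hyperscaling d_f+β/ν=3 with lower-tail control, FALSE for d>6 under η=0 (Aizenman1997 Thm 4), numerics only in d=3.
sources: EasoHutchcroft2024, Aizenman1997, BorgsChayesKestenSpencer1999, Tasaki1987, arXiv:1302.0421
[target] X = ThinClusterRarity ∧ NoCriticalTorusGiant (both parts spelled out; see the two crux
blocks). -/
@[route_item "route-CriticalPhenomena-PercTorusSliceFilling"]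
def Target : Prop :=
  (∃ C : ℝ, ∀ m : ℕ, 1 ≤ m → ∫ ω, (Literature.Probability.Percolation.siteToBoundary 3 m).indicator (fun ω => ((Set.ncard {y : Literature.Probability.LatticeModels.Site 3 | ω ∈ Literature.Probability.Percolation.openConnIn (↑(Literature.Probability.LatticeModels.box 3 m)) 0 y} : ℝ))⁻¹) ω ∂(Literature.Probability.Percolation.bondPercolation (Literature.Probability.LatticeModels.zdGraph 3) (Literature.Probability.Percolation.criticalProbI 3)) ≤ C / (m : ℝ) ^ 3) ∧ ∀ ε : ℝ, 0 < ε → Filter.Tendsto (fun n : ℕ => (Literature.Probability.Percolation.bondPercolation (Literature.Probability.LatticeModels.torusGraph 3 n) (Literature.Probability.Percolation.criticalProbI 3)).real {ω | ∃ x : Literature.Probability.LatticeModels.TorusSite 3 n, ε * (n : ℝ) ^ 3 ≤ ((Literature.Probability.Percolation.openCluster ω x).ncard : ℝ)}) Filter.atTop (nhds 0)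

/-- item stmt-CriticalPhenomena-5407 · crux · rank 2 · closed · proved by Summit.CriticalPhenomena.PercolationContinuityZ3.Theorems.TorusSliceFillingNoCriticalTorusGiant.noCriticalTorusGiant_proof @ daf50e3e23c8 (prover) · by planner
why it might fail: Necessary for θ(p_c)=0 (torus cluster ≤_st Z^3 cluster, BS96 Thm 1 = HvdH2017 Prop 13.7, + Markov): false iff a giant-bearing jump world; no same-p tool excludes a critical giant on (Z/nZ)^3 — EH2024 Rem 1.4 calls even 'no multiple giants' open; BGN1991/DCST2016 need a boundary the torus lacks.
sources: EasoHutchcroft2024, BenjaminiSchramm1996, HeydenreichVanDerHofstad2017, BarskyGrimmettNewman1991, DuminilCopinSidoraviciusTassion2016, Hutchcroft2021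
[crux] T-B of the card: for Bernoulli bond percolation on the discrete torus (ℤ/nℤ)³ (torusGraph 3
n) at the ℤ³-critical parameter p_c(ℤ³) (criticalProbI 3), for every ε > 0 the probability that some
open cluster has at least ε n³ vertices tends to 0 as n → ∞. Necessary for the conjunct (HvdH2017
Prop 13.7 domination + Markov); given TorusNonProliferation and SliceFillingUpperBound it is
equivalent to it. [difficulty: open-problem] -/
@[route_item "route-CriticalPhenomena-PercTorusSliceFilling"]
def NoCriticalTorusGiant : Prop :=
  ∀ ε : ℝ, 0 < ε → Filter.Tendsto (fun n : ℕ => (Literature.Probability.Percolation.bondPercolation (Literature.Probability.LatticeModels.torusGraph 3 n) (Literature.Probability.Percolation.criticalProbI 3)).real {ω | ∃ x : Literature.Probability.LatticeModels.TorusSite 3 n, ε * (n : ℝ) ^ 3 ≤ ((Literature.Probability.Percolation.openCluster ω x).ncard : ℝ)}) Filter.atTop (nhds 0)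

/-- item stmt-CriticalPhenomena-5414 · crux · rank 3 · open · by planner
why it might fail: Unproved d=3 hyperscaling + lower tail; false for d>6 under η=0 (~L^{d-6} thin spanning clusters, Aizenman1997 Thm 4); SHARP as typed: Cauchy–Schwarz E[1_A/|C^B|] ≥ π_m²/E[|C^B|;A_m], so a log correction to 2β/ν=1+η or a fat lower tail of |C^B| on A_m breaks O(m^-3); d=3: Tasaki1987 one-sided only.
sources: Aizenman1997, BorgsChayesKestenSpencer1999, Tasaki1987, Kesten1986, arXiv:1302.0421
[crux] TCR of the card in BOX form (K_n(0) replaced by the box cluster, so that only a static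
coupling is needed): there is C such that for all m ≥ 1, E_{p_c}[ 1{0 ↔ ∂^{in}B(m) inside B(m)} ·
|{y : 0 ↔ y inside B(m)}|⁻¹ ] ≤ C/m³ on ℤ³ (B(m) = box 3 m = [−m,m]³, one-arm event siteToBoundary 3
m). Equivalently: a long arm with a thin box cluster is rare — P(A_m, |C^{B(m)}(0)| < λ m³π(m)) ≲
λ^{1+κ} π(m) — i.e. hyperscaling d_f + β/ν = 3 with lower-tail control. [difficulty: XL] -/
@[route_item "route-CriticalPhenomena-PercTorusSliceFilling"]
def ThinClusterRarity : Prop :=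
  ∃ C : ℝ, ∀ m : ℕ, 1 ≤ m → ∫ ω, (Literature.Probability.Percolation.siteToBoundary 3 m).indicator (fun ω => ((Set.ncard {y : Literature.Probability.LatticeModels.Site 3 | ω ∈ Literature.Probability.Percolation.openConnIn (↑(Literature.Probability.LatticeModels.box 3 m)) 0 y} : ℝ))⁻¹) ω ∂(Literature.Probability.Percolation.bondPercolation (Literature.Probability.LatticeModels.zdGraph 3) (Literature.Probability.Percolation.criticalProbI 3)) ≤ C / (m : ℝ) ^ 3

/-- item stmt-CriticalPhenomena-5415 · crux · rank 4 · open · by planner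
why it might fail: Tightness of the number of spanning-type critical clusters is dimension-dependent: PROVED proliferation N~L^{d-6} for d>6, η=0 (Aizenman1997 Thm 4), tight only in d=2 (Thm 3); d=3: no bound either way (two-arm bounds only, Cerf2015), MC only (E N_sf≈1.5, n≤32); in-route only via the stronger TCR.
sources: Aizenman1997, BorgsChayesKestenSpencer1999, Cerf2015, arXiv:1302.0421, Summits/CriticalPhenomena/PercolationContinuityZ3/Ideas/torus-slice-filling-identity-v2.md
[crux] T-A of the card: at p_c(ℤ³) the number N_sf(T_n) of slice-filling open clusters of the torus
(clusters S = C(x) such that for some direction i every slice {y_i = t}, t ∈ ℤ/n, meets S) is tight: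
for every δ > 0 there is M with P(N_sf ≥ M) ≤ δ for all n ≥ 3. Follows from ThinClusterRarity via
SliceFillingTransport (support ThinClusterTransport); the assembly consumes this form. [deps:
ThinClusterRarity] [difficulty: L] -/
@[route_item "route-CriticalPhenomena-PercTorusSliceFilling"]
def TorusNonProliferation : Prop :=
  ∀ δ : ℝ, 0 < δ → ∃ M : ℕ, ∀ n : ℕ, 3 ≤ n → (Literature.Probability.Percolation.bondPercolation (Literature.Probability.LatticeModels.torusGraph 3 n) (Literature.Probability.Percolation.criticalProbI 3)).real {ω | M ≤ Set.ncard {S : Set (Literature.Probability.LatticeModels.TorusSite 3 n) | (∃ x, S = Literature.Probability.Percolation.openCluster ω x) ∧ ∃ i : Fin 3, ∀ t : ZMod n, ∃ y ∈ S, y i = t}} ≤ δ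

/-- item stmt-CriticalPhenomena-14213 · support · rank 9 · closed · proved by Summit.CriticalPhenomena.PercolationContinuityZ3.Theorems.cruxesGiveTarget_proof @ 9832dbd9f3f6 (prover) · by planner
sources: Summits/CriticalPhenomena/PercolationContinuityZ3/Ideas/torus-slice-filling-identity-v2.md
[glue] Cruxes → Target: the target X of the thesis is literally the conjunction of the two cruxes
ThinClusterRarity (TCR, rank 3) and NoCriticalTorusGiant (T-B, rank 2), so TCR → T-B → Target is
conjunction introduction (`fun h₁ h₂ => ⟨h₁, h₂⟩`, checked in the planner's Sketch.lean). Filed so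
that the target closes as soon as both cruxes do; the deciding theorem keeps consuming the weaker
TorusNonProliferation (reached from TCR by ThinClusterTransport) rather than TCR itself.
[difficulty: provable-now] -/
@[route_item "route-CriticalPhenomena-PercTorusSliceFilling"]
def CruxesGiveTarget : Prop :=
  ThinClusterRarity → NoCriticalTorusGiant → Target

/-- item stmt-CriticalPhenomena-5416 · support · rank 9 · closed · proved by Summit.CriticalPhenomena.PercolationContinuityZ3.Theorems.sliceFillingUpperBound_proof @ 1d05a6b05952 (prover) · by planner
sources: HeydenreichVanDerHofstad2017, BenjaminiSchramm1996, Summits/CriticalPhenomena/PercolationContinuityZ3/Ideas/torus-slice-filling-identity-v2.md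
[support] Lemma A of the card, upper-bound direction, at any base point: for all p, n ≥ 3 and x ∈
T_n, θ_{ℤ³}(p) ≤ P_{T_n,p}(C(x) is slice-filling). Proof: θ(p) ≤ P_{ℤ³}(diam_∞ C(0) ≥ n−1) = 1 − P(∃
s ∈ [0,n−2]³: C(0) ⊆ −s + [0,n−2]³); on the torus 'C(x) not sf' = ∃ t ∈ (ℤ/n ∖ {x_i})³: C(x) avoids
the three slices {y_i = t_i}; both unions have identical inclusion–exclusion expansions because an
intersection of such events is 'C ⊆ B' for a sub-box B ∋ base point with ≤ n−1 points per side
(torus side: the component of x in a product of arcs is the product of the arcs through x), and for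
such B the event is determined by the edges inside B plus its edge boundary, on which Torus.proj is
a bijection respecting the event and both marginals are Bernoulli(p) products (setBernoulli
restricted; bondPercolation_map_shift for the base point). [difficulty: provable-now] -/
@[route_item "route-CriticalPhenomena-PercTorusSliceFilling"]
def SliceFillingUpperBound : Prop :=
  ∀ (p : unitInterval) (n : ℕ), 3 ≤ n → ∀ x : Literature.Probability.LatticeModels.TorusSite 3 n, Literature.Probability.Percolation.theta (Literature.Probability.LatticeModels.zdGraph 3) 0 p ≤ (Literature.Probability.Percolation.bondPercolation (Literature.Probability.LatticeModels.torusGraph 3 n) p).real {ω | ∃ i : Fin 3, ∀ t : ZMod n, ∃ y ∈ Literature.Probability.Percolation.openCluster ω x, y i = t}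

/-- item stmt-CriticalPhenomena-5417 · support · rank 9 · closed · proved by Summit.CriticalPhenomena.PercolationContinuityZ3.Theorems.sliceFillingTransport_proof @ e3d19b0e6725 (prover) · by planner
sources: HeydenreichVanDerHofstad2017, LyonsPeres2016, Summits/CriticalPhenomena/PercolationContinuityZ3/Ideas/torus-slice-filling-identity-v2.md
[support] Lemma E of the card, box form: for all p and n ≥ 4, with m = ⌊(n−2)/2⌋, E_{T_n,p}[N_sf] ≤
n³ · E_{ℤ³,p}[1{0 ↔ ∂^{in}B(m) in B(m)}/|C^{B(m)}(0)|]. Proof: N_sf = Σ_x 1{C(x) sf}/|C(x)| (each sf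
cluster contributes 1); for each x, sf ⇒ C(x) leaves proj(x̂ + B(m)) (2m+1 ≤ n−1, so some slice is
missed by the projected box) through an inner-boundary vertex reached inside it, and |C(x)| ≥
|C^{loc}(x)| (cluster of x inside proj(x̂+B(m))); the pair (exit event, |C^{loc}(x)|) is a function
of the edges inside proj(x̂+B(m)), which Torus.proj identifies (graph isomorphism, 2m ≤ n−2) with
the edges inside x̂+B(m) ⊂ ℤ³, both carrying Bernoulli(p) product law; translation invariance of
bondPercolation (zdGraph 3) moves x̂ to 0. No transitivity of the torus measure is needed.
[difficulty: provable-now] -/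
@[route_item "route-CriticalPhenomena-PercTorusSliceFilling"]
def SliceFillingTransport : Prop :=
  ∀ (p : unitInterval) (n : ℕ), 4 ≤ n → ∫ ω, (Set.ncard {S : Set (Literature.Probability.LatticeModels.TorusSite 3 n) | (∃ x, S = Literature.Probability.Percolation.openCluster ω x) ∧ ∃ i : Fin 3, ∀ t : ZMod n, ∃ y ∈ S, y i = t} : ℝ) ∂(Literature.Probability.Percolation.bondPercolation (Literature.Probability.LatticeModels.torusGraph 3 n) p) ≤ (n : ℝ) ^ 3 * ∫ ω, (Literature.Probability.Percolation.siteToBoundary 3 ((n - 2) / 2)).indicator (fun ω => ((Set.ncard {y : Literature.Probability.LatticeModels.Site 3 | ω ∈ Literature.Probability.Percolation.openConnIn (↑(Literature.Probability.LatticeModels.box 3 ((n - 2) / 2))) 0 y} : ℝ))⁻¹) ω ∂(Literature.Probability.Percolation.bondPercolation (Literature.Probability.LatticeModels.zdGraph 3) p)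

/-- item stmt-CriticalPhenomena-5418 · support · rank 9 · closed · proved by Summit.CriticalPhenomena.PercolationContinuityZ3.Theorems.thinClusterTransport_proof @ 3e2dc781441f (prover) · by planner
sources: Summits/CriticalPhenomena/PercolationContinuityZ3/Ideas/torus-slice-filling-identity-v2.md, Aizenman1997
[support] ThinClusterRarity → TorusNonProliferation (spelled out). Proof: by SliceFillingTransport
at p = p_c and TCR, E N_sf ≤ n³ · C/m³ ≤ 512 C for n ≥ 4 (m = ⌊(n−2)/2⌋ ≥ (n−3)/2 ≥ n/8); N_sf ≤ 27
for n = 3; Markov. [difficulty: provable-now] -/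
@[route_item "route-CriticalPhenomena-PercTorusSliceFilling"]
def ThinClusterTransport : Prop :=
  (∃ C : ℝ, ∀ m : ℕ, 1 ≤ m → ∫ ω, (Literature.Probability.Percolation.siteToBoundary 3 m).indicator (fun ω => ((Set.ncard {y : Literature.Probability.LatticeModels.Site 3 | ω ∈ Literature.Probability.Percolation.openConnIn (↑(Literature.Probability.LatticeModels.box 3 m)) 0 y} : ℝ))⁻¹) ω ∂(Literature.Probability.Percolation.bondPercolation (Literature.Probability.LatticeModels.zdGraph 3) (Literature.Probability.Percolation.criticalProbI 3)) ≤ C / (m : ℝ) ^ 3) → ∀ δ : ℝ, 0 < δ → ∃ M : ℕ, ∀ n : ℕ, 3 ≤ n → (Literature.Probability.Percolation.bondPercolation (Literature.Probability.LatticeModels.torusGraph 3 n) (Literature.Probability.Percolation.criticalProbI 3)).real {ω | M ≤ Set.ncard {S : Set (Literature.Probability.LatticeModels.TorusSite 3 n) | (∃ x, S = Literature.Probability.Percolation.openCluster ω x) ∧ ∃ i : Fin 3, ∀ t : ZMod n, ∃ y ∈ S, y i = t}} ≤ δ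

/-- item stmt-CriticalPhenomena-5419 · assembly · rank 1 · closed · proved by Summit.CriticalPhenomena.PercolationContinuityZ3.Theorems.percTorusSliceFilling_assembly_proof (prover) · by planner
sources: Grimmett1999, Summits/CriticalPhenomena/PercolationContinuityZ3/Ideas/torus-slice-filling-identity-v2.md
[assembly] SliceFillingUpperBound → TorusNonProliferation → NoCriticalTorusGiant →
PercolationContinuityZ3. -/
@[route_item "route-CriticalPhenomena-PercTorusSliceFilling"]
def Assembly : Prop :=
  SliceFillingUpperBound → TorusNonProliferation → NoCriticalTorusGiant → PercolationContinuityZ3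

/-! D-0027 §2.1 — DECIDING THEOREM (planner-authored via `route open/edit --closes-file`; by planner-rbadge-CriticalPhenomena-PercTorusSlic-6fa1be42-g4-0 2026-08-15T16:08:49Z):
its hypotheses are this route's items and its conclusion the sub-problem Statement (glue_lint), and it elaborates with this file. -/

/-- Deciding theorem (D-0027 §2.1). The three load-bearing items of the thesis — the quotient
identity's upper bound `θ(p) ≤ P_{T_n,p}(C(x) slice-filling)` (support `SliceFillingUpperBound`),
tightness of the number of slice-filling clusters of the critical 3-torus (crux
`TorusNonProliferation`, itself reached from `ThinClusterRarity` via `ThinClusterTransport`) and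
the absence of a critical torus giant (crux `NoCriticalTorusGiant`) — are combined by the
elementary finite-graph bookkeeping item `Assembly` into `θ(p_c) = 0` on `ℤ³`, i.e. the
sub-problem statement `PercolationContinuityZ3` by name. -/
@[closes "route-CriticalPhenomena-PercTorusSliceFilling"] theorem closes (h_SliceFillingUpperBound : SliceFillingUpperBound)
    (h_TorusNonProliferation : TorusNonProliferation)
    (h_NoCriticalTorusGiant : NoCriticalTorusGiant) (h_Assembly : Assembly) :
    _root_.PercolationContinuityZ3 :=
  h_Assembly h_SliceFillingUpperBound h_TorusNonProliferation h_NoCriticalTorusGiant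

end Summit.CriticalPhenomena.PercolationContinuityZ3.Theses.PercTorusSliceFilling
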